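import Mathlib
import Summits.Ventures.HodgeRepro0.P8K3LatticeADefs
import Summits.Ventures.HodgeRepro0.P8K3LatticeA1
import Summits.Ventures.HodgeRepro0.P8K3LatticeA2
import Summits.Ventures.HodgeRepro0.P8K3LatticeA3
import Summits.Ventures.HodgeRepro0.P8K3LatticeA4

/-!
# P8K3LatticeADet (seat p8) — `P * G * Q = diagonal d` and `|det G| = 36` for the family-(A) lattice

Assembles the diagonalisation from the four product modules and reads off the determinant; no heavy evaluation here. Since `d` has
sixteen entries `±1` and two entries `±6`, the Smith normal form of `G` is `(1¹⁶, 6, 6)`: the discriminant group of `(ℤ¹⁸, G)` is `(ℤ/6)²`.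
-/

namespace HodgeRepro0.P8K3LatticeA

/-- Diagonalisation of `G` by unimodular matrices. -/
theorem P_G_Q : P * G * Q = Matrix.diagonal d := by
  rw [P_mul_G, PGm_mul_Q, Dm_eq]

/-- `|det G| = 36`. -/
theorem abs_det_G : |G.det| = 36 := by
  have h := congrArg Matrix.det P_G_Q
  rw [Matrix.det_mul, Matrix.det_mul, Matrix.det_diagonal] at h
  have hP := det_unit_of_mul_eq_one P_mul_Pinv
  have hQ := det_unit_of_mul_eq_one Q_mul_Qinv
  have hd : ∏ i, d i = 36 := by rw [← FinVec.prod_eq]; rfl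
  rw [hd] at h
  have : |P.det| * |G.det| * |Q.det| = 36 := by rw [← abs_mul, ← abs_mul, h]; norm_num
  rw [hP, hQ] at this; simpa using this

end HodgeRepro0.P8K3LatticeA
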